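import Literature.AlgebraicGeometry.Morphisms.SectionsAffineBaseChange
import Literature.AlgebraicGeometry.Morphisms.CechModuleUnit
import Literature.AlgebraicGeometry.Modules.IdealSheafNoetherian
import Literature.Algebra.Module.FlatKernelArtinianDevissage
import Mathlib.AlgebraicGeometry.Morphisms.Separated
import Mathlib.AlgebraicGeometry.Morphisms.Flat
import HarnessLib

/-!
# `Γ(X, 𝒪_X) = R` for a flat quasi-compact separated `X → Spec R`, `R` Artin local, with Stein special fibre
# (cohomological flatness in dimension 0 at an Artin point: Görtz–Wedhorn II, Exercise 23.43, Cor. 24.63; EGA III 7.7–7.8)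

Topic `AlgebraicGeometry/Morphisms`; namespace `Literature.AlgebraicGeometry.Morphisms`; a *proofs* file (theorems
only). Cell `hodgecm-mathlib`, (U)-lane brick (u7) «universal Stein `Γ(B_{T′}, 𝒪) = Γ(T′, 𝒪)` for abelian schemes»,
piece (u7-ii) = the ARTIN-LOCAL base (consumer: (u7-iii) Noetherian-local bases by formal functions, B-p17;
★ `AbelianSchemes/AbelianSchemeSteinOfArtinian` for the abelian-scheme wrappers).

* §1 **The Čech comparison.** For a cartesian square `Z = X ×_{Spec R} Spec T → X` (`T` ANY `R`-algebra) and a finite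
  affine open cover `𝒰` of `X` with affine pairwise intersections, the base change of Čech cochains
  `T ⊗_R Čᵖ(𝒰, 𝒪_X) ≅ Čᵖ(g⁻¹𝒰, 𝒪_Z)` (`p = 0, 1`; ★ `Morphisms/SectionsAffineBaseChange`) identifies
  `ker(d⁰ ⊗ T)` with `Ȟ⁰(g⁻¹𝒰, 𝒪_Z) = Γ(Z, 𝒪_Z)` (★ `cechMH0EquivSections`) and `a ⊗ 1` with `f_Z^*(a)`; hence
  **`existsUnique_tmul_one_iff_bijective_toSectionsBase`**: «every element of `ker(d⁰ ⊗ T)` is `a ⊗ 1` for a unique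
  `a ∈ T`» (the `u`-generation of ★ `Algebra/Module/FlatKernelArtinianDevissage`, `u = 1 ∈ Č⁰`) iff
  `T → Γ(Z, 𝒪_Z)` is bijective (`bijective_toSectionsBase_iff_bijective_appTop`: iff `f_Z^♯` on global sections is).
* §2 **`appTop_bijective_of_isArtinianRing`**: `R` Artin local, `f : X → Spec R` flat, quasi-compact, separated, with
  `Γ(X_k, 𝒪) = k` for the closed fibre `X_k = X ×_R Spec k` (`k = R ⧸ 𝔪`) ⇒ `Γ(Spec R, 𝒪) → Γ(X, 𝒪_X)` is bijective:
  the Čech terms `Č⁰, Č¹` are flat `R`-modules (flat affine charts), `d⁰(1) = 0`, `k` is `1`-generated by §1 at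
  `T = k`, so `R` is `1`-generated by the Artinian dévissage ★ `existsUnique_tmul_of_isArtinianRing`, which is the
  claim by §1 at `T = R`. No `H¹`, no coherence, no Noetherian hypothesis on `X`.

Everything is proved; no named facts; no definitions. Mathlib searched and used (pin): `Scheme.Hom.flat_appLE`,
`RingHom.flat_algebraMap_iff`, `Module.Flat.of_linearEquiv` + `DFinsupp.linearEquivFunOnFintype`, `IsAffineOpen.inf`
(separated), `QuasiCompact.compactSpace_of_compactSpace`, `IsPullback.of_hasPullback`, `IsPullback.of_horiz_isIso`;
Mathlib has no Stein / cohomology-and-base-change statements for proper morphisms.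

## References

* U. Görtz, T. Wedhorn, *Algebraic Geometry II: Cohomology of Schemes* (2023), Exercise 23.41/23.43 (p. 374),
  Cor. 24.63 (p. 404). [GortzWedhorn2023]
* A. Grothendieck, EGA III₂ (Publ. Math. IHÉS 17, 1963), §7.7–7.8. [EGAIII2]
* D. Mumford, *Abelian Varieties*, TIFR Studies in Mathematics 5 (2nd ed. 1974), §5 (pp. 46–51). [MumfordAV1970]
* The Stacks Project, Tag 02KH (Čech complex of a base change). [StacksProject]
-/

noncomputable section

open CategoryTheory AlgebraicGeometry Limits TopologicalSpace Opposite TensorProduct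
open Literature.Algebra.Module

universe u

namespace Literature.AlgebraicGeometry.Morphisms

/-! ### §1 The Čech comparison: `ker(d⁰ ⊗ T) ∋ a ⊗ 1 ↔ f_Z^*(a) ∈ Γ(Z, 𝒪_Z)` -/

section Comparison

variable {R T : Type u} [CommRing R] [CommRing T] [Algebra R T] {X Z : Scheme.{u}}
  (fX : X ⟶ Spec (.of R)) (fZ : Z ⟶ Spec (.of T)) (g : Z ⟶ X) {ι : Type u} (U : ι → X.Opens)

/-- `d⁰(1) = 0`: the constant cochain `(1)_i ∈ Č⁰(𝒰, 𝒪_X)` is a cocycle. [folklore]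
[cite: StacksProject, Tag 01ED (Cohomology, Section 20.9)] -/
theorem cechD0_one : cechD0 fX U 1 = 0 := by
  funext i j
  rw [cechD0_apply, Pi.one_apply, Pi.one_apply, map_one, map_one, sub_self]
  rfl

/-- `T → Γ(Z, 𝒪_Z)` (`toSectionsBase`, `a ↦ f_Z^*(a)`) is `f_Z^♯` on global sections up to `Γ(Spec T) ≅ T`.
[folklore] [cite: GortzWedhorn2023, Cor. 24.63 (p. 404), setting] -/
theorem toSectionsBase_top_apply (a : T) :
    toSectionsBase R fZ ⊤ a = fZ.appTop ((Scheme.ΓSpecIso (.of T)).inv a) := by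
  change Z.presheaf.map (homOfLE (le_top : (⊤ : Z.Opens) ≤ ⊤)).op (fZ.appTop ((Scheme.ΓSpecIso (.of T)).inv a)) = _
  have : (homOfLE (le_top : (⊤ : Z.Opens) ≤ ⊤)).op = 𝟙 _ := Subsingleton.elim _ _
  rw [this, Z.presheaf.map_id]
  rfl

/-- **`T → Γ(Z, 𝒪_Z)` is bijective iff `f_Z^♯ : Γ(Spec T, 𝒪) → Γ(Z, 𝒪_Z)` is.** [folklore]
[cite: GortzWedhorn2023, Cor. 24.63 (p. 404), setting] -/
theorem bijective_toSectionsBase_iff_bijective_appTop :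
    Function.Bijective (toSectionsBase R fZ ⊤) ↔ Function.Bijective fZ.appTop := by
  have h : (toSectionsBase R fZ ⊤ : T → Sections (restrictBase R fZ) ⊤) =
      (fZ.appTop : Γ(Spec (.of T), ⊤) → Γ(Z, ⊤)) ∘ (Scheme.ΓSpecIso (.of T)).inv :=
    funext (toSectionsBase_top_apply fZ)
  have hbij : Function.Bijective ((Scheme.ΓSpecIso (.of T)).inv : T → Γ(Spec (.of T), ⊤)) :=
    (Scheme.ΓSpecIso (.of T)).symm.commRingCatIsoToRingEquiv.bijective
  rw [h]
  exact Function.Bijective.of_comp_iff _ hbij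

/-- **`R → Γ(X, 𝒪_X)` (`algebraMapΓ f = f^♯ ∘ (Γ(Spec R) ≅ R)⁻¹`) is bijective iff `f^♯` is** — the junction with
the `algebraMapΓ` currency of ★ `Morphisms/FormalFunctions` (consumed by (u7-iii)). [folklore]
[cite: GortzWedhorn2023, Cor. 24.63 (p. 404), setting] -/
theorem bijective_algebraMapΓ_iff_bijective_appTop {Y : Scheme.{u}} (f : Y ⟶ Spec (.of R)) :
    Function.Bijective (algebraMapΓ f) ↔ Function.Bijective f.appTop := by
  have hbij : Function.Bijective ((Scheme.ΓSpecIso (.of R)).inv : R → Γ(Spec (.of R), ⊤)) :=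
    (Scheme.ΓSpecIso (.of R)).symm.commRingCatIsoToRingEquiv.bijective
  exact Function.Bijective.of_comp_iff _ hbij

/-- `bcC0 (a ⊗ 1) = (f_Z^*(a)|_{g⁻¹U_i})_i` — the image of `a ⊗ 1` is the restriction family of the global function
`f_Z^*(a)`. [folklore] [cite: StacksProject, Tag 02KH (proof: Čech complex of the base change)] -/
theorem bcC0_tmul_one (hg : g ≫ fX = restrictBase R fZ) (a : T) (i : ι) :
    bcC0 fX fZ g hg U (a ⊗ₜ[R] (1 : CechC0 fX U)) i =
      Sections.res (restrictBase R fZ) le_top (toSectionsBase R fZ ⊤ a) := by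
  have h1 : bcC0 fX fZ g hg U (a ⊗ₜ[R] (1 : CechC0 fX U)) i =
      toSectionsBase R fZ _ a * Sections.comap fX (restrictBase R fZ) g hg le_rfl ((1 : CechC0 fX U) i) := rfl
  rw [h1, Pi.one_apply, map_one, mul_one]
  exact ((Sections.res fZ (le_top : g ⁻¹ᵁ U i ≤ ⊤)).commutes a).symm

variable [Finite ι]

/-- **The Čech comparison.** For a cartesian square `Z = X ×_{Spec R} Spec T` (`T` any `R`-algebra) and a finite
cover `𝒰` of `X` by affine opens with affine pairwise intersections: every element of `ker(d⁰ ⊗_R T)` in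
`T ⊗_R Č⁰(𝒰, 𝒪_X)` is `a ⊗ 1` for a UNIQUE `a ∈ T` **iff** `T → Γ(Z, 𝒪_Z)` is bijective. (`T ⊗ Č⁰ ≅ Č⁰(g⁻¹𝒰)`,
`T ⊗ Č¹ ≅ Č¹(g⁻¹𝒰)` commute with `d⁰`, so `ker(d⁰ ⊗ T) ≅ Ȟ⁰(g⁻¹𝒰, 𝒪_Z) = Γ(Z, 𝒪_Z)`, and `a ⊗ 1 ↦ f_Z^*(a)`.)
[cite: StacksProject, Tag 02KH (proof: Čech complex of the base change)] [cite: GortzWedhorn2023, Cor. 24.63 (p. 404), step] -/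
theorem existsUnique_tmul_one_iff_bijective_toSectionsBase
    (H : IsPullback g fZ fX (Spec.map (CommRingCat.ofHom (algebraMap R T))))
    (hU : ∀ i, IsAffineOpen (U i)) (hU2 : ∀ i j, IsAffineOpen (U i ⊓ U j)) (hcov : ⨆ i, U i = ⊤) :
    (∀ x : T ⊗[R] CechC0 fX U, (cechD0 fX U).lTensor T x = 0 → ∃! a : T, a ⊗ₜ[R] (1 : CechC0 fX U) = x) ↔
      Function.Bijective (toSectionsBase R fZ ⊤) := by
  -- the players: `Φ₀, Φ₁` (cochain base change, bijective / injective), `E` (gluing), `σ = toSectionsBase`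
  have hΦ₀ := bcC0_bijective_of_isAffineOpen fX fZ g U H hU
  have hΦ₁ := (bcC1_bijective_of_isAffineOpen fX fZ g U H hU2).1
  have hcov' : ⨆ i, preimageFamily g U i = ⊤ := by
    change ⨆ i, g ⁻¹ᵁ U i = ⊤
    rw [← Scheme.Hom.preimage_iSup, hcov, Scheme.Hom.preimage_top]
  let E := cechMH0EquivSections (restrictBase R fZ) (preimageFamily g U) (SheafOfModules.unit Z.ringCatSheaf) hcov'
  -- `ker(d⁰ ⊗ T) = Φ₀⁻¹ (ker d⁰_Z)`
  have hker : ∀ x : T ⊗[R] CechC0 fX U, (cechD0 fX U).lTensor T x = 0 ↔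
      cechD0 (restrictBase R fZ) (preimageFamily g U) (bcC0 fX fZ g H.w U x) = 0 := by
    intro x
    rw [← bcC1_lTensor_cechD0]
    exact ⟨fun h => by rw [h, map_zero], fun h => hΦ₁ (h.trans (map_zero _).symm)⟩
  -- membership in `Ȟ⁰ = ker d⁰` (★ `cechMH0_unit`, definitional)
  have hmemE : ∀ s, cechD0 (restrictBase R fZ) (preimageFamily g U)
      (E s : CechMC0 (restrictBase R fZ) (SheafOfModules.unit Z.ringCatSheaf) (preimageFamily g U)) = 0 :=
    fun s => (E s).2
  -- `Φ₀ (a ⊗ 1) = E (σ a)`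
  have hE : ∀ a : T, bcC0 fX fZ g H.w U (a ⊗ₜ[R] 1) = (E (toSectionsBase R fZ ⊤ a) : CechMC0 (restrictBase R fZ) (SheafOfModules.unit Z.ringCatSheaf) (preimageFamily g U)) := by
    intro a
    funext i
    rw [bcC0_tmul_one]
    rfl
  constructor
  · -- `u`-generation ⇒ `σ` bijective
    intro hgen
    refine ⟨fun a a' haa' => ?_, fun s => ?_⟩
    · obtain ⟨a₀, -, huniq⟩ := hgen (a ⊗ₜ[R] 1) ((hker _).2 (by rw [hE]; exact hmemE _))
      have h' : a' ⊗ₜ[R] (1 : CechC0 fX U) = a ⊗ₜ[R] 1 := by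
        apply hΦ₀.1
        rw [hE, hE, haa']
      exact (huniq a rfl).trans (huniq a' h').symm
    · -- a global section `s`: its restriction family is `Φ₀ x` with `x ∈ ker(d⁰ ⊗ T)`, so `x = a ⊗ 1`
      obtain ⟨x, hx⟩ := hΦ₀.2 (E s : CechMC0 (restrictBase R fZ) (SheafOfModules.unit Z.ringCatSheaf) (preimageFamily g U))
      have hx0 : (cechD0 fX U).lTensor T x = 0 := by rw [hker, hx]; exact hmemE s
      obtain ⟨a, ha, -⟩ := hgen x hx0
      refine ⟨a, E.injective (Subtype.ext ?_)⟩
      change (E (toSectionsBase R fZ ⊤ a) : CechMC0 (restrictBase R fZ) (SheafOfModules.unit Z.ringCatSheaf) (preimageFamily g U)) = (E s : CechMC0 (restrictBase R fZ) (SheafOfModules.unit Z.ringCatSheaf) (preimageFamily g U))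
      rw [← hE, ha, hx]
  · -- `σ` bijective ⇒ `u`-generation
    intro hσ x hx
    have hmem : bcC0 fX fZ g H.w U x ∈ cechMH0 (restrictBase R fZ) (SheafOfModules.unit Z.ringCatSheaf)
        (preimageFamily g U) := (hker x).1 hx
    obtain ⟨s, hs⟩ := E.surjective ⟨_, hmem⟩
    obtain ⟨a, rfl⟩ := hσ.2 s
    refine ⟨a, hΦ₀.1 ?_, fun a' ha' => hσ.1 (E.injective (Subtype.ext ?_))⟩
    · rw [hE, hs]
    · change (E (toSectionsBase R fZ ⊤ a') : CechMC0 (restrictBase R fZ) (SheafOfModules.unit Z.ringCatSheaf) (preimageFamily g U)) = (E (toSectionsBase R fZ ⊤ a) : CechMC0 (restrictBase R fZ) (SheafOfModules.unit Z.ringCatSheaf) (preimageFamily g U))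
      rw [← hE, ha', hs]

end Comparison

/-! ### §2 Artin local base: `Γ(X_k, 𝒪) = k ⇒ Γ(X, 𝒪) = R` -/

section Artinian

variable {R : Type u} [CommRing R] {X : Scheme.{u}} (f : X ⟶ Spec (.of R))

/-- The sections of a flat `R`-scheme over an AFFINE open form a flat `R`-module (`f^♯ : R → Γ(X, V)` is a flat ring
map: Mathlib `Scheme.Hom.flat_appLE`). [folklore] [cite: GortzWedhorn2023, Exercise 23.43 (p. 374)] -/
theorem flat_sections_of_isAffineOpen [Flat f] {V : X.Opens} (hV : IsAffineOpen V) : Module.Flat R (Sections f V) := by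
  have h := f.flat_appLE (isAffineOpen_top _) hV le_top
  have e : algebraMap R (Sections f V) = (f.appLE ⊤ V le_top).hom.comp (Scheme.ΓSpecIso (.of R)).inv.hom :=
    RingHom.ext fun _ => rfl
  have hflat : (algebraMap R (Sections f V)).Flat := by
    rw [e]
    exact (RingHom.Flat.of_bijective (Scheme.ΓSpecIso (.of R)).symm.commRingCatIsoToRingEquiv.bijective).comp h
  exact RingHom.flat_algebraMap_iff.mp hflat

/-- `Č⁰(𝒰, 𝒪_X)` is a flat `R`-module for a finite affine cover of a flat `R`-scheme. [folklore]
[cite: GortzWedhorn2023, Exercise 23.43 (p. 374)] -/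
theorem flat_cechC0 [Flat f] {ι : Type u} [Finite ι] (U : ι → X.Opens) (hU : ∀ i, IsAffineOpen (U i)) :
    Module.Flat R (CechC0 f U) := by
  classical
  cases nonempty_fintype ι
  haveI : ∀ i, Module.Flat R (Sections f (U i)) := fun i => flat_sections_of_isAffineOpen f (hU i)
  exact Module.Flat.of_linearEquiv (DFinsupp.linearEquivFunOnFintype (M := fun i => Sections f (U i))).symm

/-- `Č¹(𝒰, 𝒪_X)` is a flat `R`-module when the pairwise intersections are affine. [folklore]
[cite: GortzWedhorn2023, Exercise 23.43 (p. 374)] -/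
theorem flat_cechC1 [Flat f] {ι : Type u} [Finite ι] (U : ι → X.Opens) (hU2 : ∀ i j, IsAffineOpen (U i ⊓ U j)) :
    Module.Flat R (CechC1 f U) := by
  classical
  cases nonempty_fintype ι
  haveI : ∀ i j, Module.Flat R (Sections f (U i ⊓ U j)) := fun i j => flat_sections_of_isAffineOpen f (hU2 i j)
  haveI : ∀ i, Module.Flat R ((j : ι) → Sections f (U i ⊓ U j)) := fun i =>
    Module.Flat.of_linearEquiv (DFinsupp.linearEquivFunOnFintype (M := fun j => Sections f (U i ⊓ U j))).symm
  exact Module.Flat.of_linearEquiv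
    (DFinsupp.linearEquivFunOnFintype (M := fun i => (j : ι) → Sections f (U i ⊓ U j))).symm

/-- **Cohomological flatness in dimension `0` at an Artin local base** (Görtz–Wedhorn II, Exercise 23.41/23.43; the
Artin-level step of Cor. 24.63): let `R` be an Artin local ring with residue field `k`, `f : X → Spec R` FLAT,
quasi-compact and separated, and assume the special fibre is Stein: `Γ(Spec k, 𝒪) → Γ(X ×_R Spec k, 𝒪)` is
bijective. Then `f^♯ : Γ(Spec R, 𝒪) → Γ(X, 𝒪_X)` is bijective (`Γ(X, 𝒪_X) = R`). Proof: §1 at `T = k` makes `k`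
`1`-generated for the Čech differential `d⁰ : Č⁰ → Č¹` (flat terms) of a finite affine cover; the dévissage
★ `existsUnique_tmul_of_isArtinianRing` makes `R` `1`-generated; §1 at `T = R` (identity square) concludes.
[cite: GortzWedhorn2023, Exercise 23.43 (p. 374)] [cite: GortzWedhorn2023, Cor. 24.63 (p. 404), step] -/
theorem appTop_bijective_of_isArtinianRing [IsArtinianRing R] [IsLocalRing R] [Flat f] [QuasiCompact f]
    [IsSeparated f]
    (hk : Function.Bijective (pullback.snd f
      (Spec.map (CommRingCat.ofHom (algebraMap R (IsLocalRing.ResidueField R))))).appTop) :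
    Function.Bijective f.appTop := by
  classical
  -- a finite affine cover of `X` with affine pairwise intersections
  haveI : CompactSpace X := QuasiCompact.compactSpace_of_compactSpace f
  haveI : X.IsSeparated :=
    ⟨by rw [show terminal.from X = f ≫ terminal.from _ from terminal.hom_ext _ _]; infer_instance⟩
  obtain ⟨t, ht⟩ := Modules.exists_finite_affineOpens_iSup_eq_top (X := X)
  let U : ↥t → X.Opens := fun V => ((V : X.affineOpens) : X.Opens)
  have hU : ∀ i, IsAffineOpen (U i) := fun V => V.1.2
  have hU2 : ∀ i j, IsAffineOpen (U i ⊓ U j) := fun i j => (hU i).inf (hU j)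
  have hcov : ⨆ i, U i = ⊤ := ht
  haveI := flat_cechC0 f U hU
  haveI := flat_cechC1 f U hU2
  -- the special fibre `X_k` is `1`-generated (§1 at `T = k`)
  have Hk := IsPullback.of_hasPullback f
    (Spec.map (CommRingCat.ofHom (algebraMap R (IsLocalRing.ResidueField R))))
  have hgen_k := (existsUnique_tmul_one_iff_bijective_toSectionsBase f _ _ U Hk hU hU2 hcov).2
    ((bijective_toSectionsBase_iff_bijective_appTop _).2 hk)
  -- dévissage: `R` is `1`-generated
  have hgen_R := existsUnique_tmul_of_isArtinianRing (cechD0 f U) 1 (cechD0_one f U) hgen_k R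
  -- §1 at `T = R` (the identity square)
  have HR : IsPullback (𝟙 X) f f (Spec.map (CommRingCat.ofHom (algebraMap R R))) := by
    rw [Algebra.algebraMap_self, CommRingCat.ofHom_id, Spec.map_id]
    exact IsPullback.of_horiz_isIso ⟨by rw [Category.id_comp, Category.comp_id]⟩
  exact (bijective_toSectionsBase_iff_bijective_appTop f).1
    ((existsUnique_tmul_one_iff_bijective_toSectionsBase f f (𝟙 X) U HR hU hU2 hcov).1 hgen_R)

end Artinian

end Literature.AlgebraicGeometry.Morphisms

end
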